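import Summits.BirchSwinnertonDyer.BirchSwinnertonDyer.Theorems.ManinLocalTwoThreeTameCellLocalTwoTorsionHolds
import Literature.NumberTheory.EllipticCurves.NeronComponentIndexTypeIVProofs
import Literature.NumberTheory.DiophantineGeometry.TateAlgorithmEvalProofs
import Literature.NumberTheory.DiophantineGeometry.TateAlgorithmExitMinimalityProofs
import Literature.NumberTheory.DiophantineGeometry.TateAlgorithmIstarEvalProofs
import Literature.NumberTheory.DiophantineGeometry.TateAlgorithmInvarianceProofs
import Literature.NumberTheory.DiophantineGeometry.ConductorRingOfIntegersProofs
import Literature.NumberTheory.DiophantineGeometry.TameAdditiveTypesAtTwoProofs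
import Literature.NumberTheory.EllipticCurves.QuadraticTwistJInvariantProofs
import Literature.NumberTheory.EllipticCurves.QuadraticTwistPadicReduction
import Literature.NumberTheory.EllipticCurves.TamagawaSubgroupProofs
import Literature.NumberTheory.EllipticCurves.QuadraticTwistLocalDataAtTwoPadicGlueProofs
import HarnessLib

/-!
# S-an-58 IS A THEOREM: `f₂(W) = 2 ⟹ f₂(W ⊗ χ₋₄) = 4` — the `χ₋₄`-twist of a TAME additive curve at `2` (Kodaira IV / IV*) is of
# type II / I₀* with the same `ord₂ Δ` (Barrios–Roy–Sahajpal–Tallana–Tobin–Wiersema 2025, Thm. 5.1, rows IV / IV*, `d ≡ 3 (4)`),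
# by Tate's algorithm over `ℤ₂` (route `ManinLocalTwoThree`, crux C2 `ManinOddAtFour` stmt-BirchSwinnertonDyer-22967; cell bsd-f2-manin,
# an g32 MEMO-an §75.8 row S-an-58 `NegOneTwistConductorFourMul` = the print input of S-an-57 / «C2|_{8∣N} ⟹ C2|_{4∥N}»; p2 gen 13)

* §1 `ℤ₂` bookkeeping (a unit is `1 + 2κ`; `1 + 2x` is a unit; `2 = ϖ·ε` is the tree's `TwistGoodTwo.exists_isUnit_two_eq_uniformizer_mul_padicInt`).
* §2 **IV* ↦ I₀***: from the tree's `IV*`-normal form `[2α, 4α₂, 4α₃, 8α₄, 16α₆]` (`α₃ ∈ ℤ₂ˣ`, `exists_IVstarNormalForm_padicInt`) the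
  twist is `T = [0, −(α²+4α₂), 0, 8α₄+4αα₃, −(4α₃²+16α₆)]`; `(1,0,α,2) • T` passes Step 6 (`2 ∣ a₁,a₂`, `4 ∣ a₃,a₄`, `8 ∣ a₆`,
  cubic `X³ + pX² + r`, `r ≠ 0`, discriminant `−27r² ≠ 0` in characteristic 2) — `kodairaSymbolOfMinimal_negTwist_IVstar`.
* §3 **IV ↦ II**: from the `IV`-normal form `[2α, 2α₂, 2α₃, 4α₄, 4α₆]` (`α₃ ∈ ℤ₂ˣ`, `LocalIndex.exists_smul_of_kodairaSymbolOfMinimal_eq_IV`)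
  the twist is `T = [0, −(α²+2α₂), 0, 4α₄+2αα₃, −(α₃²+4α₆)]`; `(1,0,0,1) • T` exits at Step 3 (`2 ∥ a₆`) — `kodairaSymbolOfMinimal_negTwist_IV`.
* §4 assembly `conductorExponent_quadraticTwist_negOne_eq_four_of_eq_two`: IV/IV* at `2` (`kodairaSymbolAt_of_conductorExponent_eq_two_two`),
  read over `ℤ₂` (`kodairaSymbolAt_eq_padic`, `ordMinimalDiscriminant_eq_padic`), twist transported along the total change of variables
  (`map_quadraticTwist`, `quadraticTwist_smul`), exit models are minimal (`isMinimal_baseChange_of_kodairaSymbolOfMinimal_ne_I_zero`) so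
  `kodairaSymbol` / `ord Δ_min` are read on them, and Ogg's formula (`conductorExponent_eq_padic`): `f = 8+1−5 = 4+1−1 = 4`.  Also the
  any-place form `…_eq_two'` and the conductor-norm form `padicValNat_two_conductorNorm_quadraticTwist_negOne_of_eq_two` (`v₂(N)=2 ⟹ v₂(N′)=4`).

HONEST FRAMING: a local theorem in print, now kernel-checked; it discharges the print input S-an-58 of an's S-an-57.  Nothing about BSD or
Manin's conjecture is proved; C2 OPEN. [cite: BarriosEtAl2025, Thm. 5.1 (arXiv:2501.03209 pp. 15–16), rows IV / IV*]
[cite: SilvermanATAEC1994, IV.9.4 (Steps 1–6) and IV.11.1]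
-/


set_option autoImplicit false
-- lint-debt: the directory name repeats the summit name (sibling precedent `ManinLocalTwoThreeTameCellLocalTwoTorsionHolds.lean`)
set_option linter.dupNamespace false

noncomputable section

open scoped Classical
open Polynomial IsLocalRing WeierstrassCurve
open IsDiscreteValuationRing hiding maximalIdeal
open Literature.NumberTheory.DiophantineGeometry Literature.NumberTheory.DiophantineGeometry.TateAlgorithm

namespace Summit.BirchSwinnertonDyer.BirchSwinnertonDyer.Theorems.ManinLocalTwoThree

/-! ## §1 `ℤ₂` bookkeeping -/

/-- A unit of `ℤ₂` is `1 + 2κ`. [folklore] -/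
theorem exists_eq_one_add_two_mul_of_isUnit_padicInt {u : ℤ_[2]} (hu : IsUnit u) : ∃ κ : ℤ_[2], u = 1 + 2 * κ := by
  have h1 : PadicInt.toZMod (p := 2) (u - 1) = 0 := by
    rw [map_sub, toZMod_eq_one_of_isUnit hu, map_one, sub_self]
  have hm : u - 1 ∈ IsLocalRing.maximalIdeal ℤ_[2] := by
    rw [← PadicInt.ker_toZMod]; exact h1
  rw [PadicInt.maximalIdeal_eq_span_p, Ideal.mem_span_singleton'] at hm
  obtain ⟨κ, hκ⟩ := hm
  refine ⟨κ, ?_⟩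
  have : (↑(2 : ℕ) : ℤ_[2]) = 2 := by norm_num
  rw [this] at hκ
  linear_combination -hκ

/-- `1 + 2x` is a unit of `ℤ₂`. [folklore] -/
theorem isUnit_one_add_two_mul_padicInt (x : ℤ_[2]) : IsUnit (1 + 2 * x) := by
  by_contra h
  have hm : 1 + 2 * x ∈ IsLocalRing.maximalIdeal ℤ_[2] := (IsLocalRing.mem_maximalIdeal _).mpr h
  have h2 : (2 : ℤ_[2]) ∈ IsLocalRing.maximalIdeal ℤ_[2] := by
    rw [PadicInt.maximalIdeal_eq_span_p]; exact_mod_cast Ideal.mem_span_singleton_self (2 : ℤ_[2])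
  have h1 : (1 : ℤ_[2]) ∈ IsLocalRing.maximalIdeal ℤ_[2] := by
    have := Ideal.sub_mem _ hm (Ideal.mul_mem_right x _ h2)
    rwa [add_sub_cancel_right] at this
  exact (IsLocalRing.maximalIdeal.isMaximal ℤ_[2]).ne_top (Ideal.eq_top_of_isUnit_mem _ h1 isUnit_one)

/-- In the residue field of `ℤ₂`: `(2 : k) = 0`. [folklore] -/
theorem two_eq_zero_residueField_padicInt : (2 : IsLocalRing.ResidueField ℤ_[2]) = 0 := by
  rw [← map_ofNat (IsLocalRing.residue ℤ_[2]) 2, IsLocalRing.residue_eq_zero_iff, PadicInt.maximalIdeal_eq_span_p]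
  exact_mod_cast Ideal.mem_span_singleton_self (2 : ℤ_[2])

/-! ## §2 IV* ↦ I₀*: the Step-6 run on the twisted, re-normalised `IV*`-normal form -/

/-- **The `χ₋₄`-twist of a `IV*`-normal form is of type I₀*.**  For `α, α₂, α₄, α₆ ∈ ℤ₂` and a unit `α₃`, Tate's algorithm returns
`I₀*` on `T′ = (1, 0, α, 2) • [0, −(α² + 4α₂), 0, 8α₄ + 4αα₃, −(4α₃² + 16α₆)]` (Step 6: `2 ∣ a₁, a₂`, `4 ∣ a₃, a₄`, `8 ∣ a₆`, cubic
`X³ + p X² + 1` over `𝔽₂` with discriminant `1`). [cite: SilvermanATAEC1994, IV.9.4 Step 6] -/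
theorem kodairaSymbolOfMinimal_negTwist_IVstar (α α₂ α₃ α₄ α₆ : ℤ_[2]) (hα₃ : IsUnit α₃) :
    ((⟨1, 0, α, 2⟩ : VariableChange ℤ_[2]) •
        (⟨0, -(α ^ 2 + 4 * α₂), 0, 8 * α₄ + 4 * α * α₃, -(4 * α₃ ^ 2 + 16 * α₆)⟩ : WeierstrassCurve ℤ_[2])).kodairaSymbolOfMinimal =
      .Istar 0 := by
  obtain ⟨ε, hε, hpε⟩ := Literature.NumberTheory.EllipticCurves.TwistGoodTwo.exists_isUnit_two_eq_uniformizer_mul_padicInt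
  obtain ⟨κ, hκ⟩ := exists_eq_one_add_two_mul_of_isUnit_padicInt hα₃
  set ϖ : ℤ_[2] := uniformizer ℤ_[2] with hϖ
  set T' : WeierstrassCurve ℤ_[2] := (⟨1, 0, α, 2⟩ : VariableChange ℤ_[2]) •
    (⟨0, -(α ^ 2 + 4 * α₂), 0, 8 * α₄ + 4 * α * α₃, -(4 * α₃ ^ 2 + 16 * α₆)⟩ : WeierstrassCurve ℤ_[2]) with hT'
  -- the coefficients of `T′`
  have e1 : T'.a₁ = ϖ * (ε * α) := by
    rw [hT', variableChange_a₁]; simp; linear_combination α * hpε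
  have e2 : T'.a₂ = ϖ * (-(ε * (α ^ 2 + 2 * α₂))) := by
    rw [hT', variableChange_a₂]; simp; linear_combination -(α ^ 2 + 2 * α₂) * hpε
  have e3 : T'.a₃ = ϖ ^ 2 * ε ^ 2 := by
    rw [hT', variableChange_a₃]; simp
    linear_combination (ϖ * ε + 2) * hpε
  have e4 : T'.a₄ = ϖ ^ 2 * (ϖ * (ε ^ 3 * (α₄ + α * κ))) := by
    rw [hT', variableChange_a₄]; simp; rw [hκ]
    linear_combination (α₄ + α * κ) * (ϖ ^ 2 * ε ^ 2 + 2 * ϖ * ε + 4) * hpε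
  have e6 : T'.a₆ = ϖ ^ 3 * (-(ε ^ 3 * (1 + 2 * (κ + κ ^ 2 + α₆)))) := by
    rw [hT', variableChange_a₆]; simp; rw [hκ]
    linear_combination (-(1 + 2 * (κ + κ ^ 2 + α₆))) * (ϖ ^ 2 * ε ^ 2 + 2 * ϖ * ε + 4) * hpε
  have hu₆ : IsUnit (-(ε ^ 3 * (1 + 2 * (κ + κ ^ 2 + α₆)))) :=
    ((hε.pow 3).mul (isUnit_one_add_two_mul_padicInt _)).neg
  refine kodairaSymbolOfMinimal_eq_Istar_zero_of_step6 ?_ ?_ ?_ ?_ ?_ ?_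
  · rw [e1]; exact dvd_mul_right _ _
  · rw [e2]; exact dvd_mul_right _ _
  · rw [e3]; exact dvd_mul_right _ _
  · rw [e4]; exact dvd_mul_right _ _
  · rw [e6]; exact dvd_mul_right _ _
  · rw [cubicStep6, e2, e4, e6, ← pow_one ϖ, redCoeff_uniformizer_pow_mul, pow_one, redCoeff_uniformizer_pow_mul,
      redCoeff_uniformizer_pow_mul, distinctRootCount_cubic_eq_three_iff]
    have hq : IsLocalRing.residue ℤ_[2] (ϖ * (ε ^ 3 * (α₄ + α * κ))) = 0 :=
      (IsLocalRing.residue_eq_zero_iff _).mpr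
        (Ideal.mul_mem_right _ _ ((mem_maximalIdeal_iff_dvd_of_irreducible irreducible_uniformizer _).mpr dvd_rfl))
    have hr : IsLocalRing.residue ℤ_[2] (-(ε ^ 3 * (1 + 2 * (κ + κ ^ 2 + α₆)))) ≠ 0 :=
      (IsLocalRing.residue_ne_zero_iff_isUnit _).mpr hu₆
    set P := IsLocalRing.residue ℤ_[2] (-(ε * (α ^ 2 + 2 * α₂)))
    set Rr := IsLocalRing.residue ℤ_[2] (-(ε ^ 3 * (1 + 2 * (κ + κ ^ 2 + α₆))))
    rw [hq]
    have h4 : (4 : IsLocalRing.ResidueField ℤ_[2]) = 0 := by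
      rw [show (4 : IsLocalRing.ResidueField ℤ_[2]) = 2 * 2 by norm_num, two_eq_zero_residueField_padicInt, mul_zero]
    have h27 : (27 : IsLocalRing.ResidueField ℤ_[2]) = 1 := by
      rw [show (27 : IsLocalRing.ResidueField ℤ_[2]) = 2 * 13 + 1 by norm_num, two_eq_zero_residueField_padicInt,
        zero_mul, zero_add]
    have key : P ^ 2 * 0 ^ 2 - 4 * 0 ^ 3 - 4 * P ^ 3 * Rr - 27 * Rr ^ 2 + 18 * P * 0 * Rr = -(Rr ^ 2) := by
      rw [h4, h27]; ring
    rw [key, neg_ne_zero]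
    exact pow_ne_zero 2 hr

/-! ## §3 IV ↦ II: the Step-3 run on the twisted, re-normalised `IV`-normal form -/

/-- `Δ` of a model `[0, A₂, 0, A₄, A₆]` is `16·disc(x³ + A₂x² + A₄x + A₆)`; `u = 1` changes do not move it. [folklore] -/
theorem Δ_negTwist_IV (α α₂ α₃ α₄ α₆ : ℤ_[2]) :
    ((⟨1, 0, 0, 1⟩ : VariableChange ℤ_[2]) •
        (⟨0, -(α ^ 2 + 2 * α₂), 0, 4 * α₄ + 2 * α * α₃, -(α₃ ^ 2 + 4 * α₆)⟩ : WeierstrassCurve ℤ_[2])).Δ =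
      16 * ((-(α ^ 2 + 2 * α₂)) ^ 2 * (4 * α₄ + 2 * α * α₃) ^ 2 - 4 * (4 * α₄ + 2 * α * α₃) ^ 3
        - 4 * (-(α ^ 2 + 2 * α₂)) ^ 3 * (-(α₃ ^ 2 + 4 * α₆)) - 27 * (-(α₃ ^ 2 + 4 * α₆)) ^ 2
        + 18 * (-(α ^ 2 + 2 * α₂)) * (4 * α₄ + 2 * α * α₃) * (-(α₃ ^ 2 + 4 * α₆))) := by
  rw [variableChange_Δ]
  simp only [WeierstrassCurve.Δ, WeierstrassCurve.b₂, WeierstrassCurve.b₄, WeierstrassCurve.b₆, WeierstrassCurve.b₈,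
    inv_one, Units.val_one, one_pow, one_mul]
  ring

/-- **The `χ₋₄`-twist of a `IV`-normal form is of type II.**  For `α, α₂, α₄, α₆ ∈ ℤ₂` and a unit `α₃`, Tate's algorithm returns `II`
on `T′ = (1, 0, 0, 1) • [0, −(α² + 2α₂), 0, 4α₄ + 2αα₃, −(α₃² + 4α₆)]` (Steps 1–3: `2 ∣ Δ, a₃, a₄, a₆, b₂` and `4 ∤ a₆ = −2·unit`).
[cite: SilvermanATAEC1994, IV.9.4 Steps 1–3] -/
theorem kodairaSymbolOfMinimal_negTwist_IV (α α₂ α₃ α₄ α₆ : ℤ_[2]) (hα₃ : IsUnit α₃) :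
    ((⟨1, 0, 0, 1⟩ : VariableChange ℤ_[2]) •
        (⟨0, -(α ^ 2 + 2 * α₂), 0, 4 * α₄ + 2 * α * α₃, -(α₃ ^ 2 + 4 * α₆)⟩ : WeierstrassCurve ℤ_[2])).kodairaSymbolOfMinimal =
      .II := by
  obtain ⟨ε, hε, hpε⟩ := Literature.NumberTheory.EllipticCurves.TwistGoodTwo.exists_isUnit_two_eq_uniformizer_mul_padicInt
  obtain ⟨κ, hκ⟩ := exists_eq_one_add_two_mul_of_isUnit_padicInt hα₃
  set ϖ : ℤ_[2] := uniformizer ℤ_[2] with hϖ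
  set T' : WeierstrassCurve ℤ_[2] := (⟨1, 0, 0, 1⟩ : VariableChange ℤ_[2]) •
    (⟨0, -(α ^ 2 + 2 * α₂), 0, 4 * α₄ + 2 * α * α₃, -(α₃ ^ 2 + 4 * α₆)⟩ : WeierstrassCurve ℤ_[2]) with hT'
  have e3 : T'.a₃ = ϖ * ε := by
    rw [hT', variableChange_a₃]; simp; linear_combination hpε
  have e4 : T'.a₄ = ϖ * (ε * (2 * α₄ + α * α₃)) := by
    rw [hT', variableChange_a₄]; simp; linear_combination (2 * α₄ + α * α₃) * hpε
  have e6 : T'.a₆ = ϖ * (-(ε * (1 + 2 * (κ + κ ^ 2 + α₆)))) := by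
    rw [hT', variableChange_a₆]; simp; rw [hκ]
    linear_combination (-(1 + 2 * (κ + κ ^ 2 + α₆))) * hpε
  have eb2 : T'.b₂ = ϖ * (-(2 * ε * (α ^ 2 + 2 * α₂))) := by
    rw [WeierstrassCurve.b₂, hT', variableChange_a₁, variableChange_a₂]; simp
    linear_combination (-(2 * (α ^ 2 + 2 * α₂))) * hpε
  have hu₆ : IsUnit (-(ε * (1 + 2 * (κ + κ ^ 2 + α₆)))) := (hε.mul (isUnit_one_add_two_mul_padicInt _)).neg
  have hΔ : ϖ ∣ T'.Δ := by
    rw [hT', Δ_negTwist_IV]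
    refine Dvd.dvd.mul_right ?_ _
    exact ⟨8 * ε, by linear_combination 8 * hpε⟩
  refine kodairaSymbolOfMinimal_eq_II_of_step2 hΔ ?_ ?_ ?_ ?_ ?_
  · rw [e3]; exact dvd_mul_right _ _
  · rw [e4]; exact dvd_mul_right _ _
  · rw [e6]; exact dvd_mul_right _ _
  · rw [eb2]; exact dvd_mul_right _ _
  · rw [e6, pow_two]
    intro h
    have hϖ0 : ϖ ≠ 0 := irreducible_uniformizer.ne_zero
    have h' : ϖ ∣ -(ε * (1 + 2 * (κ + κ ^ 2 + α₆))) := by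
      obtain ⟨c, hc⟩ := h
      exact ⟨c, mul_left_cancel₀ hϖ0 (by rw [hc]; ring)⟩
    exact (isUnit_iff_not_dvd irreducible_uniformizer _).mp hu₆ h'


/-! ## §4 The global assembly: `f₂(W) = 2 ⟹ f₂(W ⊗ χ₋₄) = 4` -/

/-- The `χ₋₄`-twist of the `IV*`-normal form `[2α, 4α₂, 4α₃, 8α₄, 16α₆]`, read over `ℚ₂`, is the integral model
`[0, −(α² + 4α₂), 0, 8α₄ + 4αα₃, −(4α₃² + 16α₆)]`. [cite: SilvermanAEC2009, X.2 Prop. 2.4 (shape of the quadratic twist)] -/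
theorem quadraticTwist_negOne_map_of_IVstarNormalForm (N : WeierstrassCurve ℤ_[2]) {α α₂ α₃ α₄ α₆ : ℤ_[2]}
    (h₁ : N.a₁ = 2 * α) (h₂ : N.a₂ = 4 * α₂) (h₃ : N.a₃ = 4 * α₃) (h₄ : N.a₄ = 8 * α₄) (h₆ : N.a₆ = 16 * α₆) :
    (N.map (algebraMap ℤ_[2] ℚ_[2])).quadraticTwist (-1) =
      (⟨0, -(α ^ 2 + 4 * α₂), 0, 8 * α₄ + 4 * α * α₃, -(4 * α₃ ^ 2 + 16 * α₆)⟩ : WeierstrassCurve ℤ_[2]).map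
        (algebraMap ℤ_[2] ℚ_[2]) := by
  obtain ⟨a₁, a₂, a₃, a₄, a₆⟩ := N
  simp only at h₁ h₂ h₃ h₄ h₆
  subst h₁ h₂ h₃ h₄ h₆
  have c2 : ((2 : ℤ_[2]) : ℚ_[2]) = 2 := map_ofNat PadicInt.Coe.ringHom 2
  have c4 : ((4 : ℤ_[2]) : ℚ_[2]) = 4 := map_ofNat PadicInt.Coe.ringHom 4
  have c8 : ((8 : ℤ_[2]) : ℚ_[2]) = 8 := map_ofNat PadicInt.Coe.ringHom 8
  have c16 : ((16 : ℤ_[2]) : ℚ_[2]) = 16 := map_ofNat PadicInt.Coe.ringHom 16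
  ext <;> simp [WeierstrassCurve.quadraticTwist, WeierstrassCurve.map, WeierstrassCurve.b₂, WeierstrassCurve.b₄,
    WeierstrassCurve.b₆, c2, c4, c8, c16] <;> ring

/-- The `χ₋₄`-twist of the `IV`-normal form `[2α, 2α₂, 2α₃, 4α₄, 4α₆]`, read over `ℚ₂`, is the integral model
`[0, −(α² + 2α₂), 0, 4α₄ + 2αα₃, −(α₃² + 4α₆)]`. [cite: SilvermanAEC2009, X.2 Prop. 2.4 (shape of the quadratic twist)] -/
theorem quadraticTwist_negOne_map_of_IVNormalForm (N : WeierstrassCurve ℤ_[2]) {α α₂ α₃ α₄ α₆ : ℤ_[2]}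
    (h₁ : N.a₁ = 2 * α) (h₂ : N.a₂ = 2 * α₂) (h₃ : N.a₃ = 2 * α₃) (h₄ : N.a₄ = 4 * α₄) (h₆ : N.a₆ = 4 * α₆) :
    (N.map (algebraMap ℤ_[2] ℚ_[2])).quadraticTwist (-1) =
      (⟨0, -(α ^ 2 + 2 * α₂), 0, 4 * α₄ + 2 * α * α₃, -(α₃ ^ 2 + 4 * α₆)⟩ : WeierstrassCurve ℤ_[2]).map
        (algebraMap ℤ_[2] ℚ_[2]) := by
  obtain ⟨a₁, a₂, a₃, a₄, a₆⟩ := N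
  simp only at h₁ h₂ h₃ h₄ h₆
  subst h₁ h₂ h₃ h₄ h₆
  have c2 : ((2 : ℤ_[2]) : ℚ_[2]) = 2 := map_ofNat PadicInt.Coe.ringHom 2
  have c4 : ((4 : ℤ_[2]) : ℚ_[2]) = 4 := map_ofNat PadicInt.Coe.ringHom 4
  ext <;> simp [WeierstrassCurve.quadraticTwist, WeierstrassCurve.map, WeierstrassCurve.b₂, WeierstrassCurve.b₄,
    WeierstrassCurve.b₆, c2, c4] <;> ring

/-- **Ogg's formula for the `χ₋₄`-twist read on an explicit exit model over `ℤ₂`.**  If `Cfin • (W ⊗ (−1)) ⊗ ℚ₂ = T′ ⊗ ℚ₂` for a `ℤ₂`-model `T′`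
on which Tate's algorithm exits (not `I₀`), then `f₂(W ⊗ (−1)) = ord₂ Δ(T′) + 1 − m(T′)`.
[cite: SilvermanATAEC1994, IV.9.4 and IV.11.1] [cite: SilvermanAEC2009, VII.1 Prop. 1.3(b)] -/
theorem conductorExponent_negTwist_of_exitModel (W : WeierstrassCurve ℚ) [W.IsElliptic]
    (T' : WeierstrassCurve ℤ_[2]) (Cfin : VariableChange ℚ_[2])
    (h : T'.map (algebraMap ℤ_[2] ℚ_[2]) = Cfin • (W.quadraticTwist ((-1 : ℤ) : ℚ)).baseChange ℚ_[2])
    (hne : T'.kodairaSymbolOfMinimal ≠ .I 0) :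
    (W.quadraticTwist ((-1 : ℤ) : ℚ)).conductorExponent ((Rat.HeightOneSpectrum.primesEquiv (R := ℤ)).symm ⟨2, Nat.prime_two⟩) =
      (IsDiscreteValuationRing.addVal ℤ_[2] T'.Δ).toNat + 1 - T'.kodairaSymbolOfMinimal.numComponents := by
  haveI : Fact (Nat.Prime 2) := ⟨Nat.prime_two⟩
  haveI : Finite (ResidueField ℤ_[2]) := Finite.of_equiv _ (PadicInt.residueField (p := 2)).toEquiv.symm
  have hd0 : ((-1 : ℤ) : ℚ) ≠ 0 := by norm_num
  haveI := W.isElliptic_quadraticTwist hd0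
  set v : IsDedekindDomain.HeightOneSpectrum ℤ := (Rat.HeightOneSpectrum.primesEquiv (R := ℤ)).symm ⟨2, Nat.prime_two⟩ with hvdef
  have e : Rat.HeightOneSpectrum.primesEquiv (R := ℤ) v = ⟨2, Nat.prime_two⟩ := Equiv.apply_symm_apply _ _
  set Wm : WeierstrassCurve ℚ := W.quadraticTwist ((-1 : ℤ) : ℚ) with hWm
  set Xm : WeierstrassCurve ℚ_[2] := Wm.baseChange ℚ_[2] with hXm
  -- the exit model is minimal
  haveI hmin : (T'.baseChange ℚ_[2]).IsMinimal ℤ_[2] :=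
    isMinimal_baseChange_of_kodairaSymbolOfMinimal_ne_I_zero (K := ℚ_[2]) T' hne
  have hTb : T'.baseChange ℚ_[2] = Cfin • Xm := h
  have hΔ : (T'.baseChange ℚ_[2]).Δ ≠ 0 := by
    rw [hTb]; exact (Cfin • Xm).isUnit_Δ.ne_zero
  have hkod : Xm.kodairaSymbol ℤ_[2] = T'.kodairaSymbolOfMinimal := by
    rw [kodairaSymbol_eq_kodairaSymbolOfMinimal_of_isMinimal (R := ℤ_[2]) Xm (T'.baseChange ℚ_[2]) Cfin hTb hΔ,
      WeierstrassCurve.integralModel_baseChange_eq]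
  have hord : (IsDiscreteValuationRing.addVal ℤ_[2] ((Xm.minimal ℤ_[2]).integralModel ℤ_[2]).Δ).toNat =
      (IsDiscreteValuationRing.addVal ℤ_[2] T'.Δ).toNat := by
    rw [addVal_Δ_minimal_toNat_eq_of_isMinimal (R := ℤ_[2]) Xm (T'.baseChange ℚ_[2]) Cfin hTb hΔ,
      WeierstrassCurve.integralModel_baseChange_eq]
  have hf := WeierstrassCurve.conductorExponent_eq_padic (R := ℤ) v Wm
  rw [e] at hf
  change Wm.conductorExponent v =
    (IsDiscreteValuationRing.addVal ℤ_[2] ((Xm.minimal ℤ_[2]).integralModel ℤ_[2]).Δ).toNat + 1 -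
      (Xm.kodairaSymbol ℤ_[2]).numComponents at hf
  rw [hf, hord, hkod]

/-- **S-an-58 (an g32, MEMO-an §75.8) IS A THEOREM — Barrios–Roy–Sahajpal–Tallana–Tobin–Wiersema 2025 Thm. 5.1, rows IV / IV*,
`d ≡ 3 (mod 4)`, kernel-checked for `d = −1`**: for an elliptic curve `W/ℚ` with conductor exponent `f₂(W) = 2` (tame additive
reduction at `2`: Kodaira IV or IV*), the `χ₋₄`-twist has `f₂(W ⊗ (−1)) = 4` (types II resp. I₀*, same `ord₂ Δ_min ∈ {4, 8}`).
[cite: BarriosEtAl2025, Thm. 5.1 (arXiv:2501.03209 pp. 15–16), rows IV / IV*, column (f, f^d)] [cite: SilvermanATAEC1994, IV.9.4 and IV.11.1] -/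
theorem conductorExponent_quadraticTwist_negOne_eq_four_of_eq_two (W : WeierstrassCurve ℚ) [W.IsElliptic]
    (hf : W.conductorExponent ((Rat.HeightOneSpectrum.primesEquiv (R := ℤ)).symm ⟨2, Nat.prime_two⟩) = 2) :
    (W.quadraticTwist ((-1 : ℤ) : ℚ)).conductorExponent
        ((Rat.HeightOneSpectrum.primesEquiv (R := ℤ)).symm ⟨2, Nat.prime_two⟩) = 4 := by
  haveI : Fact (Nat.Prime 2) := ⟨Nat.prime_two⟩
  haveI : Finite (ResidueField ℤ_[2]) := Finite.of_equiv _ (PadicInt.residueField (p := 2)).toEquiv.symm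
  have hirr : Irreducible (2 : ℤ_[2]) := by exact_mod_cast PadicInt.irreducible_p (p := 2)
  set v : IsDedekindDomain.HeightOneSpectrum ℤ := (Rat.HeightOneSpectrum.primesEquiv (R := ℤ)).symm ⟨2, Nat.prime_two⟩
    with hvdef
  have hv : Rat.HeightOneSpectrum.natGenerator v = 2 :=
    congrArg Subtype.val ((Rat.HeightOneSpectrum.primesEquiv (R := ℤ)).apply_symm_apply ⟨2, Nat.prime_two⟩)
  have e : Rat.HeightOneSpectrum.primesEquiv (R := ℤ) v = ⟨2, Nat.prime_two⟩ := Equiv.apply_symm_apply _ _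
  -- Kodaira IV / IV* and `ord Δ_min`, read over `ℤ₂`
  have hK := W.kodairaSymbolAt_of_conductorExponent_eq_two_two v hv hf
  have hKp := WeierstrassCurve.kodairaSymbolAt_eq_padic (R := ℤ) v W
  rw [e] at hKp
  change W.kodairaSymbolAt v = (((W.baseChange ℚ_[2]).minimal ℤ_[2]).integralModel ℤ_[2]).kodairaSymbolOfMinimal at hKp
  have hOp := WeierstrassCurve.ordMinimalDiscriminant_eq_padic (R := ℤ) v W
  rw [e] at hOp
  change W.ordMinimalDiscriminant v =
    (IsDiscreteValuationRing.addVal ℤ_[2] (((W.baseChange ℚ_[2]).minimal ℤ_[2]).integralModel ℤ_[2]).Δ).toNat at hOp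
  set X : WeierstrassCurve ℚ_[2] := W.baseChange ℚ_[2] with hX
  set V₀ : WeierstrassCurve ℤ_[2] := (X.minimal ℤ_[2]).integralModel ℤ_[2] with hV₀
  set E : VariableChange ℚ_[2] := (X.exists_isMinimal ℤ_[2]).choose with hE
  have hmin : X.minimal ℤ_[2] = E • X := rfl
  have hV₀X : V₀.baseChange ℚ_[2] = X.minimal ℤ_[2] := WeierstrassCurve.baseChange_integralModel_eq ℤ_[2] _
  -- the twist over `ℚ₂`
  have hd0 : ((-1 : ℤ) : ℚ) ≠ 0 := by norm_num
  haveI := W.isElliptic_quadraticTwist hd0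
  set Xm : WeierstrassCurve ℚ_[2] := (W.quadraticTwist ((-1 : ℤ) : ℚ)).baseChange ℚ_[2] with hXm
  have hXmX : Xm = X.quadraticTwist (-1) := by
    rw [hXm, hX, WeierstrassCurve.baseChange, WeierstrassCurve.baseChange, WeierstrassCurve.map_quadraticTwist]
    simp
  -- common step: from a normal form `N = D • V₀` with `Ctot • X = N ⊗ ℚ₂` and a twist model `T` to the exit model `C₆ • T`
  have key : ∀ (D : VariableChange ℤ_[2]) (T : WeierstrassCurve ℤ_[2]) (C₆ : VariableChange ℤ_[2]),
      ((D • V₀).map (algebraMap ℤ_[2] ℚ_[2])).quadraticTwist (-1) = T.map (algebraMap ℤ_[2] ℚ_[2]) →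
      (C₆ • T).kodairaSymbolOfMinimal ≠ .I 0 →
      (W.quadraticTwist ((-1 : ℤ) : ℚ)).conductorExponent v =
        (IsDiscreteValuationRing.addVal ℤ_[2] V₀.Δ).toNat + 1 - (C₆ • T).kodairaSymbolOfMinimal.numComponents := by
    intro D T C₆ hNT hne
    set Ctot : VariableChange ℚ_[2] := D.map (algebraMap ℤ_[2] ℚ_[2]) * E with hCtot
    have hCX : Ctot • X = (D • V₀).map (algebraMap ℤ_[2] ℚ_[2]) := by
      rw [hCtot, mul_smul, ← hmin, ← hV₀X]
      exact WeierstrassCurve.map_variableChange _ _ _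
    set C₁ : VariableChange ℚ_[2] := ⟨Ctot.u, (-1) * Ctot.r, 0, 0⟩ with hC₁
    have hT : T.map (algebraMap ℤ_[2] ℚ_[2]) = C₁ • Xm := by
      rw [← hNT, ← hCX, WeierstrassCurve.quadraticTwist_smul, hXmX]
    have hT' : (C₆ • T).map (algebraMap ℤ_[2] ℚ_[2]) = (C₆.map (algebraMap ℤ_[2] ℚ_[2]) * C₁) • Xm := by
      rw [mul_smul, ← hT]
      exact (WeierstrassCurve.map_variableChange _ _ _).symm
    rw [conductorExponent_negTwist_of_exitModel W (C₆ • T) _ hT' hne, addVal_Δ_smul_toNat]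
    -- `Δ(T) = Δ(N)`: compare over `ℚ₂`, where `T ⊗ ℚ₂ = (N ⊗ ℚ₂)^{(-1)}` has discriminant `(-1)⁶ Δ`
    have hΔT : (T.Δ : ℚ_[2]) = ((D • V₀).Δ : ℚ_[2]) := by
      have h1 : (T.map (algebraMap ℤ_[2] ℚ_[2])).Δ = (((D • V₀).map (algebraMap ℤ_[2] ℚ_[2])).quadraticTwist (-1)).Δ := by
        rw [hNT]
      rw [WeierstrassCurve.map_Δ, WeierstrassCurve.quadraticTwist_Δ, WeierstrassCurve.map_Δ] at h1
      norm_num at h1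
      exact h1
    have hΔT' : T.Δ = (D • V₀).Δ := IsFractionRing.injective ℤ_[2] ℚ_[2] hΔT
    rw [hΔT', addVal_Δ_smul_toNat]
  rcases hK with ⟨hIV, hord⟩ | ⟨hIVs, hord⟩
  · -- Kodaira IV: the twist is of type II with `ord Δ = 4`
    rw [hIV] at hKp
    obtain ⟨D, h1m, h2m, h3m, h4m, h6m, hb6⟩ :=
      Literature.NumberTheory.EllipticCurves.LocalIndex.exists_smul_of_kodairaSymbolOfMinimal_eq_IV V₀ hKp.symm
    obtain ⟨α, hα⟩ := (mem_maximalIdeal_iff_dvd_of_irreducible hirr _).mp h1m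
    obtain ⟨α₂, hα₂⟩ := (mem_maximalIdeal_iff_dvd_of_irreducible hirr _).mp h2m
    obtain ⟨α₃, hα₃⟩ := (mem_maximalIdeal_iff_dvd_of_irreducible hirr _).mp h3m
    obtain ⟨α₄, hα₄⟩ := (mem_maximalIdeal_pow_iff_dvd_of_irreducible hirr _ _).mp h4m
    obtain ⟨α₆, hα₆⟩ := (mem_maximalIdeal_pow_iff_dvd_of_irreducible hirr _ _).mp h6m
    have hα₃u : IsUnit α₃ := by
      by_contra hnu
      obtain ⟨β, hβ⟩ := padicInt_two_eq_two_mul_of_not_isUnit hnu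
      apply hb6
      rw [mem_maximalIdeal_pow_iff_dvd_of_irreducible hirr, WeierstrassCurve.b₆, hα₃, hα₆, hβ]
      exact ⟨2 * β ^ 2 + 2 * α₆, by ring⟩
    have h4' : (D • V₀).a₄ = 4 * α₄ := by rw [hα₄]; ring
    have h6' : (D • V₀).a₆ = 4 * α₆ := by rw [hα₆]; ring
    have hNT := quadraticTwist_negOne_map_of_IVNormalForm (D • V₀) hα hα₂ hα₃ h4' h6'
    have hexit := kodairaSymbolOfMinimal_negTwist_IV α α₂ α₃ α₄ α₆ hα₃u
    rw [key D _ ⟨1, 0, 0, 1⟩ hNT (by rw [hexit]; decide), hexit, ← hOp, hord]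
    rfl
  · -- Kodaira IV*: the twist is of type I₀* with `ord Δ = 8`
    rw [hIVs] at hKp
    obtain ⟨D, α, α₂, α₃, α₄, α₆, h₁, h₂, h₃, hα₃, h₄', h₆⟩ := exists_IVstarNormalForm_padicInt V₀ hKp.symm
    have hNT := quadraticTwist_negOne_map_of_IVstarNormalForm (D • V₀) h₁ h₂ h₃ h₄' h₆
    have hexit := kodairaSymbolOfMinimal_negTwist_IVstar α α₂ α₃ α₄ α₆ hα₃
    rw [key D _ ⟨1, 0, α, 2⟩ hNT (by rw [hexit]; decide), hexit, ← hOp, hord]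
    rfl

/-- **S-an-58 at any place `v` of `ℤ` above `2`** (`natGenerator v = 2`). [cite: BarriosEtAl2025, Thm. 5.1, rows IV / IV*] -/
theorem conductorExponent_quadraticTwist_negOne_eq_four_of_eq_two' (W : WeierstrassCurve ℚ) [W.IsElliptic]
    (v : IsDedekindDomain.HeightOneSpectrum ℤ) (hv : Rat.HeightOneSpectrum.natGenerator v = 2)
    (hf : W.conductorExponent v = 2) :
    (W.quadraticTwist ((-1 : ℤ) : ℚ)).conductorExponent v = 4 := by
  have hpv : Rat.HeightOneSpectrum.primesEquiv (R := ℤ) v = ⟨2, Nat.prime_two⟩ := Subtype.ext hv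
  have hvv : v = (Rat.HeightOneSpectrum.primesEquiv (R := ℤ)).symm ⟨2, Nat.prime_two⟩ := by
    rw [← hpv, Equiv.symm_apply_apply]
  subst hvv
  exact conductorExponent_quadraticTwist_negOne_eq_four_of_eq_two W hf

/-- **The conductor-norm form**: `4 ∥ N(W) ⟹ 16 ∣ N(W ⊗ (−1))` and `32 ∤ N(W ⊗ (−1))` — i.e. `v₂(N) = 2 ⟹ v₂(N′) = 4`.
[cite: BarriosEtAl2025, Thm. 5.1, rows IV / IV*] [cite: SilvermanAEC2009, C.16] -/
theorem padicValNat_two_conductorNorm_quadraticTwist_negOne_of_eq_two (W : WeierstrassCurve ℚ) [W.IsElliptic]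
    (hN : padicValNat 2 (W.conductorNorm ℤ) = 2) :
    padicValNat 2 ((W.quadraticTwist ((-1 : ℤ) : ℚ)).conductorNorm ℤ) = 4 := by
  haveI : Fact (Nat.Prime 2) := ⟨Nat.prime_two⟩
  have hd0 : ((-1 : ℤ) : ℚ) ≠ 0 := by norm_num
  haveI := W.isElliptic_quadraticTwist hd0
  set v : IsDedekindDomain.HeightOneSpectrum ℤ := (Rat.HeightOneSpectrum.primesEquiv (R := ℤ)).symm ⟨2, Nat.prime_two⟩
    with hvdef
  have hv : Rat.HeightOneSpectrum.natGenerator v = 2 :=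
    congrArg Subtype.val ((Rat.HeightOneSpectrum.primesEquiv (R := ℤ)).apply_symm_apply ⟨2, Nat.prime_two⟩)
  have hfacW : (W.conductorNorm ℤ).factorization 2 = W.conductorExponent v := by
    rw [← hv]; exact W.factorization_conductorNorm_holds v
  have hfacT : ((W.quadraticTwist ((-1 : ℤ) : ℚ)).conductorNorm ℤ).factorization 2 =
      (W.quadraticTwist ((-1 : ℤ) : ℚ)).conductorExponent v := by
    rw [← hv]; exact (W.quadraticTwist ((-1 : ℤ) : ℚ)).factorization_conductorNorm_holds v
  rw [← Nat.factorization_def _ Nat.prime_two] at hN ⊢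
  rw [hfacT]
  exact conductorExponent_quadraticTwist_negOne_eq_four_of_eq_two W (by rw [← hfacW]; exact hN)

end Summit.BirchSwinnertonDyer.BirchSwinnertonDyer.Theorems.ManinLocalTwoThree

end
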